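/- Copyright: the b2b-balaban cell (near-miss cell 7), T⁴-continuum fan-out, lineage t4-ne7-p1 (row NE7 OWNER, CRUX
PROVER NE7 #1, gen 30).  Released under the licence of the surrounding project. -/
import Summits.QuantumFields.BalabanUV.T4Continuum.Support.B16HistoryIndexedTrunc
import Literature.MathematicalPhysics.QuantumFieldTheory.Balaban1983to89.T4MatchingAssembly

/-!
# NODE O's two-run synchronisation BY NAME: row NE7b's truncation aggregate IS node U5d's class map — the NE7 owner's
answer to W-ne7bp1-g47-4 (`HOME/INBOX.md` l.9594; routed `SPINE-TRANSPOSITION-MAP.md` v1 row S-NE7, T4-DAG v75 §8 Q67)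
(v1.1: v1 = p281319 d1e67e325250; v1.1 = header locator for the admissibility FORMAT made page-exact + the `hcons` design
rule stated, §2 `hcons_of_preimage_subset` added; every v1 declaration byte-identical)

Summits-side support leaf of the T⁴-continuum cell (rung (B)+1 on a FINITE torus only; NOT infinite volume, NOT the
mass gap, NOT Clay; NOT a proof of NE7 or NE7b — the cell's OWN estimates, NOT PRINTED, NOT PROVED).  [folklore]
finite-sum bookkeeping by name over `T4MatchingAssembly` §3 (node U5d: `classVal`, `classShell`, `relWeightBound_of_fibres`,
`shellWeightBound_of_fibres`, `classVal_sub_classShell`) and `B16HistoryIndexedTrunc` (row NE7b's M2-C: `aggW`, `weightB`),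
plus Mathlib's `Fin.init`; nothing printed asserted, no `def`, no `def … : Prop` fact of Bałaban's, no cite-tagged
hypothesis, zero `sorry`.

THE ASK (NE7b OWNER t4-ne7b-p1 g47, W-ne7bp1-g47-4): «run B v1 needs the MATCHING DATA `trunc` (a level-(K+1) history ↦
its level-K truncation on NODE O's synchronised skeleton) with `MapsTo` into `termSet I K` and a key-level reading of run
B's live price at run A's keys — M2-C states the shapes» → NE7 owner ∕ NODE O.

THE ANSWER, BY NAME (§1–§2).  The tree has carried NODE O's synchronisation SHAPE since `T4MatchingAssembly` (node U5d,
§3 there): run B's own term family `b` on its own finite index sets `SB K`, «partially summed into run A's classes along a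
class map `π K : σ → ι` (forgetting B's extra finest-scale data)», `classVal SB π b := T4HybridMatching.fiberSum`, with
the ONE-DIRECTIONAL consistency `hcons` «a B-term over a bad A-class is B-bad; the converse may fail at B's finest scale —
the excess is booked as run-B SHELL mass (`classShell`), so that it costs weight, never a rate».  Row NE7b's `trunc` IS
that `π` and M2-C's aggregate IS `classVal`, DEFINITIONALLY: `aggW trunc S w = classVal S trunc w` (`aggW_eq_classVal`,
`rfl`), `weightB ν RB trunc = classVal (K ↦ termSet I' (K+1)) trunc (weight ν RB)` (`weightB_eq_classVal`, `rfl`).  Hence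
(§2) the two WEIGHT clauses of `T4MatchingAssembly.HybridNE7` for the truncated pair `(A, aggW trunc S b)` come from
PER-RUN data by node U5d's constructors with `π := trunc` (`relWeightBound_aggW`, `shellWeightBound_aggW`), and NE7's
term-wise `core` clause is then asked for `A − shA` against the aggregate of run B's GOOD terms over each good class
(`aggW_sub_classShell` = `classVal_sub_classShell`).  Nothing new is owed by NODE O for the SHAPE: the `MapsTo` clause is
U5d's `hmaps`, the «key-level reading at run A's keys» is U5d's `hcons` + shell booking (row NE7c's `Wsh` absorbs run-B
terms whose offending structure lives in the forgotten finest layer).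

THE READING (§3; the NE7 owner's ruling on the CONVENTION, offered to row NE7b under the two-reader rule — [our design],
not Bałaban's text).  Synchronise the two runs BY PHYSICAL SCALE: index a history by AGE `a` = number of steps still to go
to the unit lattice (age `a` ↔ lattice spacing `L^{-a}` on the fixed torus, the SAME lattice for both runs); run A
(cutoff `K`) has ages `0 … K−1`, run B (cutoff `K+1`) ages `0 … K`; run B's step `j+1` and run A's step `j` act at the
same age.  Then `trunc K := Fin.init` (forget the age-`K` = finest-layer datum) on age-indexed histories `Fin (K+1) → D`;
`MapsTo` holds FOR FREE whenever admissibility is LOCAL IN AGE (unary conditions per age + nesting conditions between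
consecutive ages — the FORMAT of the characteristic functions (1.3)–(1.9) under the chain (1.2), [Balaban1989LargeFieldI]
p. 178, each coupling the consecutive levels `j`, `j+1` only; cited as FORMAT, nothing of it asserted):
`mapsTo_init_of_local`; the bad TERMS of run B are DEFINED as the preimage of the common bad CLASSES plus the finest-layer
offenders, so that node U5d's `hcons` holds by construction (`hcons_of_preimage_subset`, §2) — the bad-class threshold must
therefore be ONE function of the AGE profile for both runs (a step-counted threshold `⌊K∕2⌋` vs `⌊(K+1)∕2⌋` would break
`hcons` at a component of age exactly `K∕2`, `K` even); and a key read off the history CAUSALLY (the age-`a` member of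
the live family depends on the history at ages `≤ a` only) commutes with truncation, `ktrunc := Fin.init`:
`init_key_of_causal` — row NE7b's
compatibility clause `kmem K (trunc K τ') = ktrunc K (kmem' K τ')` of `B16HistoryIndexedTruncKeys` at instance level.
The INSTANCE of `π` on Bałaban's admissible sequences is therefore definable the moment row NE7b's M2 brick B instantiates
`HIndex` by age-indexed admissible sequences (their READING); no NE7-side OBJECT is missing for `trunc` itself.  What
remains NODE O's (ownerless, XL) is the FUNCTIONAL half — the weights, not the index map.

BY-NAME EFFECT ON THE WALLS.  Row NE7: none (route 1's END takes abstract `B`; this file says which `B` the NE7b side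
delivers: `aggW`-aggregates = U5d class values).  Row NE7b: W-ne7bp1-g47-4 ANSWERED — `trunc`∕`ktrunc` are `Fin.init` under
the age reading, `MapsTo` and compatibility for free from local admissibility ∕ causal keys; the weight clauses junction to
`T4MatchingAssembly` §3 by `rfl`.  NE7 ∕ NE7b NOT PROVED by this; spine 0∕9.

HONEST DEPENDENCY (cell): continuum YM on T⁴ ⇐ BetaPertH ∧ nine spine estimates (0/9 proved); BetaPertH ⇐ (D1) ∧ (D4)
∧ CAP+tail; G-an2-4 gates asym, D1 and NE2/3/4.  This file changes none of it.
-/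

open Finset
open Literature.MathematicalPhysics.QuantumFieldTheory.Balaban1983to89
open Literature.MathematicalPhysics.QuantumFieldTheory.Balaban1983to89.T4MatchingAssembly
open Literature.MathematicalPhysics.QuantumFieldTheory.Balaban1983to89.T4WeightBudget (RelWeightBound)
open Literature.MathematicalPhysics.QuantumFieldTheory.Balaban1983to89.T4IndicatorShell (ShellWeightBound)
open Literature.MathematicalPhysics.QuantumFieldTheory.Balaban1983to89.T4HybridMatching (fiberSum)
open Summit.QuantumFields.BalabanUV.T4Continuum.B16HistoryIndexedTrunc

namespace Summit.QuantumFields.BalabanUV.T4Continuum.NE7NodeOSyncTruncation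

/-! ## §1 The junction by name: M2-C's truncation aggregate is node U5d's class value -/

section Junction

variable {ι ι' : Type*} [DecidableEq ι] (trunc : ℕ → ι' → ι) (S : ℕ → Finset ι') (w : ℕ → ℝ → ι' → ℝ)

/-- **`aggW` IS `classVal`** (node U5d's partial summation of run B's own terms into run A's classes along the class map
`π := trunc`), definitionally. [folklore] -/
theorem aggW_eq_classVal : aggW trunc S w = classVal S trunc w := rfl

/-- pointwise form: the truncation aggregate over `τ` is the fibre sum of `T4HybridMatching` over `τ`. [folklore] -/
theorem aggW_apply_eq_fiberSum (K : ℕ) (t : ℝ) (τ : ι) :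
    aggW trunc S w K t τ = fiberSum (S K) (trunc K) (w K t) τ := rfl

/-- the aggregation identity of M2-C is node U5d's `sum_classVal` (both are `Finset.sum_fiberwise_of_maps_to`). [folklore] -/
theorem sum_aggW_eq_sum_classVal {T : ℕ → Finset ι} {K : ℕ} (hmaps : ∀ τ' ∈ S K, trunc K τ' ∈ T K) (t : ℝ) :
    ∑ τ ∈ T K, aggW trunc S w K t τ = ∑ τ' ∈ S K, w K t τ' :=
  sum_classVal (SB := S) (π := trunc) (b := w) hmaps t

end Junction

section WeightB

open B16HistoryIndexedRepr B16HistoryIndexedRepr.HIndex B16HistoryIndexedRepr.Repr172R MeasureTheory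

variable {DomK DomK' : ℕ → Type*} {I : (K : ℕ) → HIndex (DomK K)} {I' : (K : ℕ) → HIndex (DomK' K)}
  [DecidableEq (Idx I)] {Y : ℕ → Type*} [∀ K, MeasurableSpace (Y K)] {𝒢' : (K : ℕ) → GoodClass (Y K)}

/-- **AT M2-A's LETTERS**: run B's aggregated weights `weightB ν RB trunc` ARE node U5d's class values of run B's own
weights on its own level-`(K+1)` term sets along `trunc`, definitionally. [folklore] -/
theorem weightB_eq_classVal (ν : (K : ℕ) → Measure (Y K)) (RB : (K : ℕ) → ℝ → Repr172R (𝒢' K) (I' K))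
    (trunc : ℕ → Idx I' → Idx I) :
    weightB ν RB trunc = classVal (fun K => termSet I' (K + 1)) trunc (fun _ t τ' => weight ν RB t τ') := rfl

end WeightB

/-! ## §2 NE7's weight and shell clauses for the truncated pair, from PER-RUN data (node U5d's constructors) -/

section Clauses

variable {ι ι' : Type*} [DecidableEq ι] [DecidableEq ι'] {l₀ : ℝ} {T : ℕ → Finset ι} {A shA : ℕ → ℝ → ι → ℝ}
  {Bad : ℕ → ℝ → Finset ι} {trunc : ℕ → ι' → ι} {S : ℕ → Finset ι'} {SBad : ℕ → ℝ → Finset ι'}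
  {b : ℕ → ℝ → ι' → ℝ} {W Wsh : ℕ → ℝ}

omit [DecidableEq ι'] in
/-- **`HybridNE7.weight` FOR THE PAIR `(A, aggW trunc S b)` FROM PER-RUN DATA** (= `relWeightBound_of_fibres` with
`π := trunc`): run A's relative bad-CLASS bound on `T K`, run B's relative bad-TERM bound on ITS OWN term set `S K` with
the same weights `W`, non-negative run-B terms, `MapsTo (trunc K) (S K) (T K)`, and the one-directional consistency
`hcons` (a run-B term truncating into a bad class is itself bad).  This is the shape row NE7b delivers to NE7 once run B
is «aggregated by truncation» (R-OWNER-46-2). [folklore] -/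
theorem relWeightBound_aggW (hW0 : ∀ K, 0 ≤ W K) (hW1 : ∀ K, W K < 1) (hWs : Summable W)
    (hBad : ∀ K t, |t| ≤ l₀ → Bad K t ⊆ T K)
    (hbadA : ∀ K t, |t| ≤ l₀ → ∑ τ ∈ Bad K t, A K t τ ≤ W K * ∑ τ ∈ T K, A K t τ)
    (hmaps : ∀ K, ∀ τ' ∈ S K, trunc K τ' ∈ T K) (hSBad : ∀ K t, |t| ≤ l₀ → SBad K t ⊆ S K)
    (hcons : ∀ K t, |t| ≤ l₀ → ∀ τ' ∈ S K, trunc K τ' ∈ Bad K t → τ' ∈ SBad K t)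
    (hb : ∀ K t, |t| ≤ l₀ → ∀ τ' ∈ S K, 0 ≤ b K t τ')
    (hbadB : ∀ K t, |t| ≤ l₀ → ∑ τ' ∈ SBad K t, b K t τ' ≤ W K * ∑ τ' ∈ S K, b K t τ') :
    RelWeightBound l₀ T A (aggW trunc S b) Bad W :=
  relWeightBound_of_fibres hW0 hW1 hWs hBad hbadA hmaps hSBad hcons hb hbadB

/-- **`HybridNE7.shell` FOR THE PAIR**, run B's shell := the class sums of its bad terms (`classShell S SBad trunc b`;
node U5d's finest-scale residue over good classes included) with the relative bad-term bound `≤ Wsh K · Σ b`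
(= `shellWeightBound_of_fibres` with `π := trunc`). [folklore] -/
theorem shellWeightBound_aggW (hWsh0 : ∀ K, 0 ≤ Wsh K) (hWshs : Summable Wsh)
    (hshA0 : ∀ K t, |t| ≤ l₀ → ∀ τ ∈ T K, 0 ≤ shA K t τ) (hshA : ∀ K t, |t| ≤ l₀ → ∀ τ ∈ T K, shA K t τ ≤ A K t τ)
    (hshAW : ∀ K t, |t| ≤ l₀ → ∑ τ ∈ T K, shA K t τ ≤ Wsh K * ∑ τ ∈ T K, A K t τ)
    (hmaps : ∀ K, ∀ τ' ∈ S K, trunc K τ' ∈ T K) (hSBad : ∀ K t, |t| ≤ l₀ → SBad K t ⊆ S K)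
    (hb : ∀ K t, |t| ≤ l₀ → ∀ τ' ∈ S K, 0 ≤ b K t τ')
    (hbadB : ∀ K t, |t| ≤ l₀ → ∑ τ' ∈ SBad K t, b K t τ' ≤ Wsh K * ∑ τ' ∈ S K, b K t τ') :
    ShellWeightBound l₀ T A (aggW trunc S b) shA (classShell S SBad trunc b) Wsh :=
  shellWeightBound_of_fibres hWsh0 hWshs hshA0 hshA hshAW hmaps hSBad hb hbadB

/-- **WHAT NE7's `core` IS THEN ASKED ON**: aggregate minus shell = the fibre sum of run B's GOOD terms over the class
(`classVal_sub_classShell`) — the `B − shB` of `T4MatchingAssembly.HybridNE7.core` for the truncated pair. [folklore] -/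
theorem aggW_sub_classShell (K : ℕ) (t : ℝ) (τ : ι) :
    aggW trunc S b K t τ - classShell S SBad trunc b K t τ =
      fiberSum ((S K).filter (fun τ' => τ' ∉ SBad K t)) (trunc K) (b K t) τ :=
  classVal_sub_classShell (SB := S) (SBad := SBad) (π := trunc) (b := b) K t τ

omit [DecidableEq ι'] in
/-- run B's bad CLASSES cost at most run B's bad TERMS (U5d's `classBad_le` for the aggregate): the content of the
«key-level reading at run A's keys» — only `hcons` is needed, never its converse. [folklore] -/
theorem sum_bad_aggW_le {K : ℕ} {t : ℝ} (hcons : ∀ τ' ∈ S K, trunc K τ' ∈ Bad K t → τ' ∈ SBad K t)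
    (hSBad : SBad K t ⊆ S K) (hb : ∀ τ' ∈ S K, 0 ≤ b K t τ') :
    ∑ τ ∈ Bad K t, aggW trunc S b K t τ ≤ ∑ τ' ∈ SBad K t, b K t τ' :=
  classBad_le (SB := S) (π := trunc) (b := b) hcons hSBad hb

omit [DecidableEq ι'] in
/-- **THE DESIGN RULE THAT MAKES `hcons` HOLD BY CONSTRUCTION** (v1.1): declare run B's bad TERMS to CONTAIN the preimage
of the common bad CLASSES under the truncation (plus whatever finest-layer offenders the run-B side wants — they only
enlarge `SBad` and are booked as shell); then every run-B term truncating into a bad class is bad.  Consequently the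
bad-class criterion must be ONE function of the truncated (age-`< K`) data for both runs. [folklore] -/
theorem hcons_of_preimage_subset {K : ℕ} {t : ℝ}
    (hpre : (S K).filter (fun τ' => trunc K τ' ∈ Bad K t) ⊆ SBad K t) :
    ∀ τ' ∈ S K, trunc K τ' ∈ Bad K t → τ' ∈ SBad K t :=
  fun _ hτ' hbad => hpre (Finset.mem_filter.mpr ⟨hτ', hbad⟩)

end Clauses

/-! ## §3 The reading: age-indexed histories, `trunc := Fin.init`, `MapsTo` and key compatibility for free -/

section Reading

variable {D : Type*}

/-- **LOCAL ADMISSIBILITY IS PREFIX-CLOSED**: if a cutoff's admissible histories are the age-indexed sequences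
`h : Fin K → D` satisfying unary conditions `P a (h a)` per age and nesting conditions `R a (h a) (h (a+1))` between
consecutive ages (the same conditions at every cutoff), then forgetting the finest age, `Fin.init : (Fin (K+1) → D) →
(Fin K → D)`, maps run B's admissible histories INTO run A's — the `MapsTo (trunc K) (S K) (T K)` clause of M2-C ∕ the
`hmaps` of node U5d, with `trunc K := Fin.init`. [folklore] -/
theorem mapsTo_init_of_local (P : ℕ → D → Prop) (R : ℕ → D → D → Prop) (H : (K : ℕ) → Finset (Fin K → D))
    (hH : ∀ K h, h ∈ H K ↔ (∀ a : Fin K, P a (h a)) ∧ ∀ a b : Fin K, b.val = a.val + 1 → R a (h a) (h b))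
    (K : ℕ) : ∀ h ∈ H (K + 1), Fin.init h ∈ H K := by
  intro h hh
  obtain ⟨hP, hR⟩ := (hH (K + 1) h).1 hh
  refine (hH K (Fin.init h)).2 ⟨fun a => ?_, fun a b hab => ?_⟩
  · exact hP a.castSucc
  · exact hR a.castSucc b.castSucc hab

/-- the set-level form (no finiteness): local admissibility of `h` at cutoff `K+1` gives it for `Fin.init h` at `K`.
[folklore] -/
theorem init_admissible (P : ℕ → D → Prop) (R : ℕ → D → D → Prop) {K : ℕ} (h : Fin (K + 1) → D)
    (hP : ∀ a : Fin (K + 1), P a (h a)) (hR : ∀ a b : Fin (K + 1), b.val = a.val + 1 → R a (h a) (h b)) :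
    (∀ a : Fin K, P a (Fin.init h a)) ∧ ∀ a b : Fin K, b.val = a.val + 1 → R a (Fin.init h a) (Fin.init h b) :=
  ⟨fun a => hP a.castSucc, fun a b hab => hR a.castSucc b.castSucc hab⟩

/-- **A CAUSAL KEY COMMUTES WITH TRUNCATION** (`ktrunc := Fin.init`): if the age-`a` member of a history's key is read
off the history at ages `≤ a` only — `φ a` applied to the prefix `(h 0, …, h a)` — then the key of the truncated history
is the truncation of the key: row NE7b's compatibility clause `kmem K (trunc K τ') = ktrunc K (kmem' K τ')` of
`B16HistoryIndexedTruncKeys`, at instance level, by `rfl`. [folklore] -/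
theorem init_key_of_causal {κ : Type*} (φ : (a : ℕ) → (Fin (a + 1) → D) → κ) {K : ℕ} (h : Fin (K + 1) → D) :
    (fun a : Fin K => φ a fun b => Fin.init h ⟨b, Nat.lt_of_le_of_lt (Nat.le_of_lt_succ b.isLt) a.isLt⟩) =
      Fin.init fun a : Fin (K + 1) => φ a fun b => h ⟨b, Nat.lt_of_le_of_lt (Nat.le_of_lt_succ b.isLt) a.isLt⟩ := by
  funext a
  rfl

/-- the fibre of `Fin.init` over a run-A history `g` = the run-B histories extending `g` by ONE finest-age datum: a run-B
history lies over `g` iff it agrees with `g` at every age `< K` (its age-`K` datum is free — node U5d's «extra finest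
level INSIDE a class»). [folklore] -/
theorem init_eq_iff {K : ℕ} (h : Fin (K + 1) → D) (g : Fin K → D) :
    Fin.init h = g ↔ ∀ a : Fin K, h a.castSucc = g a :=
  ⟨fun e a => by rw [← e]; rfl, fun e => funext e⟩

end Reading

end Summit.QuantumFields.BalabanUV.T4Continuum.NE7NodeOSyncTruncation
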